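import Summits.BirchSwinnertonDyer.BirchSwinnertonDyer.Theses.UniversalToricDescent
import Summits.BirchSwinnertonDyer.BirchSwinnertonDyer.Theorems.UniversalToricDescentTwinAlgMuZeroAtThreeOfBetaRoadParam
import Summits.BirchSwinnertonDyer.BirchSwinnertonDyer.Theorems.UniversalToricDescentTwinCoherentHeegnerFamily
import Literature.NumberTheory.EllipticCurves.Castella2024.LambdaAdicHeegnerClassExistence
import Literature.NumberTheory.EllipticCurves.LambdaAdicSelmerDataProofs
import Literature.NumberTheory.EllipticCurves.CornutVatsal2007.CMPointsNontriviality
import Mathlib.Analysis.Fourier.ZMod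
import HarnessLib

/-!
# Crux r205 `TwinAlgMuZeroAtThree` (stmt-BirchSwinnertonDyer-24737) — node `mazur-log-torsion` (crux-ideate g15, 2026-08-31)

**THE MOVE (Mazur's conjecture + the kernel of the formal logarithm is torsion + finite Fourier analysis on the layer
Galois group ⟹ the `𝔭′`-localisation of the Λ-adic Heegner class is NOT Λ-torsion; Poitou–Tate reciprocity + the
maximal-isotropy of the ordinary (Greenberg) local condition then give `rank_Λ X_(∅,0)(E′/K_∞) = 0`).**
This node isolates and attacks the TORSION CONJUNCT of the crux in bucket B (`3 ∥ N′`, très ramifié) — the lineage's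
open flag F-TORS(B) (`universal_norm_defect.md` ll. 85–95, `KEEPKILL-g12` F-TORS) — with an engine none of rows 1–23
uses, and in particular WITHOUT the explicit reciprocity law / `L_𝔭^{BDP} ≠ 0` that the printed proofs of exactly this
torsion statement need (BCK21 Thm. 4.1 [corpus: paper-arxiv-1908.09512 p. 9] ← Castella JLMS 2017 App. Lemma A.4 /
Thm. A.1 ← the BDP formula; CGLS20 Prop. 4.3 / Thm. 4.4 [corpus: paper-arxiv-2008.02571 pp. 22–23]) and which are
UNPRINTED at `3 ∥ N′` (flag F-BDP-3∣N; `TWIN-PRINT-AT3-v1.md`), and WITHOUT Kolyvagin-system divisibilities (row 17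
K2a‴, item 32864), WITHOUT `L`-values, rank-free.

Informal proof carried by the stubs (details in `Lines/mazur_log_torsion.md`):
* (i) `loc_{𝔭′}(κ_∞)` Λ-torsion, `h · loc_{𝔭′}(κ_∞) = 0`, projects to the layers: for every finite-order character
  `χ` of `Γ_n = Gal(K_n/K)` with `h(χ) ≠ 0`, `Σ_{σ ∈ Γ_n} χ̄(σ) · log_{w}(σ z_n) = 0` (`w ∣ 𝔭′`, `log_w` the formal
  logarithm of `E′/K_{n,w}`, `z_n` the layer Heegner point; Kummer map injective on `E′(K_n) ⊗ ℚ₃`).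
* (ii) `h ≠ 0` has finitely many character zeros, so for `n ≫ 0` ALL characters of exact conductor `3^{n}` are
  admissible in (i); a function `φ : ℤ/3^{n} → ℚ̄₃` all of whose PRIMITIVE Fourier coefficients vanish is invariant
  under the order-3 subgroup `C = Gal(K_n/K_{n-1})` (finite Fourier inversion); hence `log_w((c−1) z_n) = 0`, and the
  kernel of `log_w` on `E′(K_{n,w})` is its torsion subgroup, so `(c − 1) z_n ∈ E′(K_n)_tors`.
* (iii) `(c − 1) z_n` torsion ⟹ `(χ(c) − 1) e_χ z_n = 0` ⟹ `e_χ z_n = 0` for EVERY primitive `χ` — contradicting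
  Mazur's conjecture (Cornut 2002; Cornut–Vatsal 2007 Thm. 1.10 / Thm. 4.1, printed for `P ∥ N` with Eichler level
  `δ = 1` and good CM points [corpus: book:burns2007-l-functions-galois-representations p. 158 Thm. 1.5, p. 188
  Thm. 4.1, p. 191 Lemma 4.9]) — stub `MazurLayerMultAtThree`.
* (iv) rank count: `r := rank_Λ 𝔖_∞ ≤ 1` (stub `LambdaRankLeOneMultAtThree`: CV non-triviality + Nekovář 2007
  Thm. 3.2 "if `p ≠ 2` then `corank S_p(E/K[p^∞]) = 1`" — ANY `p ≠ 2`, no `p ∤ N` [corpus: same book p. 563] +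
  anticyclotomic control Greenberg LNM 1716); `loc_𝔭(κ_∞)`, `loc_{𝔭′}(κ_∞)` non-torsion by (i)–(iii) and the
  `τ`-symmetry; for `c ∈ H¹_{(0 at 𝔭, ∅ at 𝔭′)}(K, 𝕋)`: Poitou–Tate reciprocity `Σ_v ⟨c_v, (τκ_∞)_v⟩_v = 0` kills
  every term but `v = 𝔭′`, the ordinary condition is maximal isotropic at the multiplicative prime `𝔭′`, so the
  singular part of `c_{𝔭′}` pairs to zero with the non-torsion ordinary class `loc_{𝔭′}(τκ_∞)`, hence is torsion;
  so (up to torsion) `c ∈ H¹_{(0,ord)} ⊆ 𝔖_∞` with `loc_𝔭 c = 0`, and `ker(loc_𝔭 |_{𝔖_∞})` is torsion because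
  `r ≤ 1` and `loc_𝔭(κ_∞)` is non-torsion; so `rank_Λ H¹_{(0,∅)} = 0 = rank_Λ X_(∅,0)` — stub
  `TorsionOfMazurRankMultAtThree` (the NEW piece, typed as the implication MAZUR ∧ RK≤1 ⟹ torsion).

**PIECES and TAGS (D-0171).**
* `MazurLayerMultAtThree` — KNOWN-IN-PRINT / PORT (Cornut–Vatsal 2007 Thm. 1.10 at `δ = 1`; the tree's named fact
  `CornutVatsal2007.thm110_exists_heegnerCharSum_ne_zero` carries `¬ p ∣ N` and must be re-typed for `p ∥ N` with good
  CM points — a Literature typing job, not research). WEAKER than the crux. Leaf: ATTACKABLE (port).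
* `LambdaRankLeOneMultAtThree` — KNOWN-MODULO-PORT (CV + Nekovář 2007 Thm. 3.2 + control). WEAKER than the crux and
  than K2a‴ (no Kolyvagin system). Leaf: ATTACKABLE (port).
* `TorsionOfMazurRankMultAtThree` — UNDECIDED in print AS AN IMPLICATION but every step is char-0 standard
  (Bloch–Kato logarithm, Tate local duality, Poitou–Tate, finite Fourier inversion); Leaf: ATTACKABLE (M–L; the
  finite-Fourier step is kernel-checkable today over `ZMod (3^n)`), INSTRUMENTABLE (15a1/ℚ(√−11): `(c−1)z_n` has
  non-zero formal log at one `n` — a Magma/PARI Heegner-point computation, not run: kit = 0).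
* `TwinSelmerTorsionMultAtThree` (TORS_B) — DERIVED here from the three stubs (`torsMult_of`), WEAKER than the
  crux (`torsMult_of_crux`), implied by the line of record (`torsMult_of_betaRoad`).
* `TwinMuZeroOfTorsionMultAtThree` (MU_B ∣ TORS) — UNDECIDED = the residual `μ`-conjunct GIVEN torsion; this node
  does not attack it: Leaf IDEA-NEEDED / handed to rows 1 (β-road: `muZeroOfTorsionMult_of_betaRoad`), 17 + 18
  (FINE‴ + isotropy), 21 (defect), 23 (parity squeeze). COSTUME-adjacent (it is the crux's B-half weakened by a
  hypothesis this node makes a theorem-modulo-ports) — declared, not hidden.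
* C₀ bucket — BY NAME `UniversalToricDescentBetaRoadParamDefs.TwinAlgMuZeroAtThreeGoodSSOfParam` (shared leaf with
  `beta_road` v19 / `dihedral_parity_squeeze`); the same log/Fourier torsion mechanism runs in C₀ on the honest
  `±`-subfamilies (`a₃ = 0`: `Tr z_{m} = −z_{m−2}`), not typed here (row 11 owns the signed algebra).

**DISPROOF USED.** `Disproof.lean` (2026-08-29, NO KILL): honours `twinAlgMuZeroAtThree_false_without_heegner` — the
Heegner hypothesis is load-bearing twice here (the Heegner family `F` exists only under it:
`twin_exists_isNormCompatible_heegnerFamily`; CV's sign/`P`-new input); no stub is an instance of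
`Negative/GuardCuts` (`not_bucketGuard_11a1`, `exists_heegner_split_not_odd`) — all stubs keep the bucket guard and
`Odd d_K` where the crux has them; habitats 15a1/ℚ(√−11) (B), 17a1/ℚ(√−35) (C₀) are instances, not counterexamples.
Negatives 24881 / 15532 unrelated. BANNED option `allowUnsafeReducibility` not used.
-/

noncomputable section

open scoped Classical NumberField

set_option linter.dupNamespace false
set_option autoImplicit false

namespace Summit.BirchSwinnertonDyer.BirchSwinnertonDyer.Cruxes.TwinAlgMuZeroAtThree.MazurLogTorsion

open NumberField IsDedekindDomain Field WeierstrassCurve Finset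
open Literature.NumberTheory.EllipticCurves Literature.NumberTheory.EllipticCurves.IwasawaAlgebra
open Literature.NumberTheory.EllipticCurves.ZpExtension Literature.NumberTheory.EllipticCurves.GreenbergSelmer
open Literature.NumberTheory.EllipticCurves.Castella2024 Literature.NumberTheory.EllipticCurves.ModularForms
open Summit.BirchSwinnertonDyer.Rank1Residual.X11b Summit.BirchSwinnertonDyer.Rank1Residual.X11b.AcSelmer
open Summit.BirchSwinnertonDyer.BirchSwinnertonDyer.Theorems

/-! ## §1 The pieces (all `Prop`s over the crux's bucket-B binders) -/

/-- **MAZUR_B — Mazur's conjecture along the anticyclotomic `ℤ₃`-tower, layer form, bucket B** (stub; KNOWN IN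
PRINT, to port): for every Heegner family `F = (z_n)_n` of `E′/K` along `κ` (`z_n ∈ E′(K_n)`, `HeegnerFamily`), for
`n ≫ 0` and every `c ∈ Gal(K̄/K_n) ∖ Gal(K̄/K_{n+1})` the point `(c − 1) z_{n+1}` is NON-TORSION. Equivalent to
"`e_χ z_{n+1} ≠ 0` for SOME character `χ` of `Gal(K_{n+1}/K)` of exact conductor" (if `(c−1)z` were torsion then
`(χ(c) − 1) e_χ z = 0` for all `χ`, killing every primitive `χ`), which is Cornut–Vatsal 2007 Thm. 1.10 (`χ₀ = 1`)
for the good CM points of conductor `3ⁿ` on `X₀(N′)`, `3 ∥ N′` (Eichler level `δ = 1`, Lemma 4.9, Thm. 4.1).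
Why it might fail: only as a PORT — the tree's `CornutVatsal2007.thm110_exists_heegnerCharSum_ne_zero` is typed with
`¬ p ∣ N`; at `p ∥ N` the printed theorem needs "good" CM points (CV Def. before Lemma 4.9) and the Heegner points of
`HeegnerFamily` (conductor `3^{n+1}`, level `N′`) must be checked good. [cite: CornutVatsal2007, Thm. 1.10, Thm. 4.1,
Lemma 4.9] [cite: Cornut2002] -/
@[conjecture] def MazurLayerMultAtThree : Prop :=
  ∀ (W' : WeierstrassCurve ℚ) [W'.IsElliptic] [W'.IsGloballyMinimal] (N' : ℕ) [NeZero N']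
    (K : Type) [Field K] [NumberField K] (_Dt' : ModularParametrizationData W' N'),
    Rank1Residual.Mult W' 3 → W'.conductorNorm ℤ = N' → IsImaginaryQuadratic K →
    SatisfiesHeegnerHypothesis N' K →
    ∀ (κ : ZpExtension K 3), κ.IsAnticyclotomic →
    ∀ (jbar : AlgebraicClosure K →+* ℂ) (F : HeegnerFamily N' W' K κ jbar),
      ∃ n₀ : ℕ, ∀ n : ℕ, n₀ ≤ n → ∀ c : absoluteGaloisGroup K,
        c ∈ κ.layerSubgroup n → c ∉ κ.layerSubgroup (n + 1) →
        ∀ m : ℤ, m ≠ 0 → m • (c • F.z (n + 1) - F.z (n + 1)) ≠ 0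

/-- **RK≤1_B — the `Λ`-adic Selmer module `𝔖_∞ = lim← S_3(E′/K_n)` has `Λ`-rank `≤ 1`, bucket B** (stub; KNOWN
MODULO PORT): Cornut–Vatsal non-triviality of the Heegner module + Nekovář 2007 Thm. 3.2 ("if `p ≠ 2` then
`corank_{ℤ_p} S_p(E/K[p^∞]) = 1`", valid for `p ∣ N`) + anticyclotomic control (Greenberg) give rank exactly `1`; only
`≤ 1` is used. WEAKER than K2a‴ (no Kolyvagin system, no `𝔭`-primary control of `X_tors`). Why it might fail: only as
a port (Nekovář's parity input at `p = 3 ∥ N`; control with `E′(K_∞)[3] = 0`).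
[cite: Nekovar2007Durham, Thm. 3.2] [cite: CornutVatsal2007, Thm. 1.5] [cite: Bertolini1995, §III]
[cite: Greenberg1999LNM1716, Prop. 3.6 (shape only)] -/
@[conjecture] def LambdaRankLeOneMultAtThree : Prop :=
  ∀ (W' : WeierstrassCurve ℚ) [W'.IsElliptic] [W'.IsGloballyMinimal] (N' : ℕ) [NeZero N']
    (K : Type) [Field K] [NumberField K] (_Dt' : ModularParametrizationData W' N'),
    Rank1Residual.Mult W' 3 → W'.conductorNorm ℤ = N' → IsImaginaryQuadratic K →
    SatisfiesHeegnerHypothesis N' K →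
    ∀ (κ : ZpExtension K 3), κ.IsAnticyclotomic →
    ∀ (γ : absoluteGaloisGroup K) [Fact (κ.IsTopGenerator γ)]
      (D : (W'.baseChange K).LambdaAdicSelmerData κ γ), Module.rank (IwasawaAlgebra 3) D.S ≤ 1

/-- **PTGLUE_B — torsion of `X_(∅,0)` from Mazur's conjecture and `rank_Λ 𝔖_∞ ≤ 1`, bucket B** (stub; the NEW piece,
UNDECIDED as an implication, every step standard in characteristic 0): given a norm-compatible Heegner family `F`
(sign `α`, `α² = 1`) satisfying the Mazur conclusion, and `rank_Λ D.S ≤ 1` for the `Λ`-adic Selmer datum, the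
strict-at-`𝔭′` / relaxed-at-`𝔭` dual Selmer group `XAc (E′/K) 3 κ 𝔭′ ∅ γ` is `Λ`-torsion. Mechanism: (i) a `Λ`-torsion
`loc_{𝔭′}` of the `Λ`-adic class `z ∈ D.S` (`IsLambdaAdicHeegnerClass`, exists by
`Castella2024.exists_isLambdaAdicHeegnerClass`) forces, via the formal logarithm at `w ∣ 𝔭′` and finite Fourier
inversion on `Gal(K_n/K) ≅ ℤ/3ⁿ`, `log_w((c−1)z_n) = 0`, i.e. `(c−1)z_n` torsion (log-kernel = torsion) for `n ≫ 0`,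
contradicting Mazur; (ii) with `loc_𝔭 z`, `loc_{𝔭′} z` non-torsion and `rank ≤ 1`, Poitou–Tate reciprocity against
`τ z` plus maximal isotropy of the ordinary condition at the multiplicative prime `𝔭′` give `rank_Λ H¹_{(0,∅)} = 0`.
Why it might fail: the `Λ`-adic bookkeeping "(c−1)z_n torsion for all large n ⟹ contradiction" needs the torsion of
`E′(K_∞)` bounded (true: `E′(K_∞)[3^∞]` finite, ρ̄₃ onto) and the identification of `XAc`'s local conditions with the
classical Kummer conditions away from `3` (`GreenbergSelmer.awayKer`; fine at good primes, to check at bad `v ∣ N′`).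
[cite: PerrinRiou1987BSMF, §3 (reciprocity shape)] [cite: BertoliniDarmon2005, §2 (ordinary isotropy, shape only)]
[cite: Castella2024MathZ, Thm. 6.2 (shape only)] -/
@[conjecture] def TorsionOfMazurRankMultAtThree : Prop :=
  ∀ (W' : WeierstrassCurve ℚ) [W'.IsElliptic] [W'.IsGloballyMinimal] (N' : ℕ) [NeZero N']
    (K : Type) [Field K] [NumberField K] (_Dt' : ModularParametrizationData W' N'),
    Rank1Residual.Mult W' 3 → ¬ 3 ∣ padicValInt 3 W'.minimalDiscriminantInt →
    W'.HasSurjectiveModNGaloisRep 3 → W'.conductorNorm ℤ = N' → IsImaginaryQuadratic K →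
    SatisfiesHeegnerHypothesis N' K → Odd (NumberField.discr K) →
    ∀ (κ : ZpExtension K 3), κ.IsAnticyclotomic →
    ∀ (γ : absoluteGaloisGroup K) [Fact (κ.IsTopGenerator γ)]
      (𝔭 : HeightOneSpectrum (𝓞 K)), ((3 : ℕ) : 𝓞 K) ∈ 𝔭.asIdeal →
      𝔭.asIdeal.ramificationIdx (𝓞 ℚ) = 1 → 𝔭.asIdeal.inertiaDeg (𝓞 ℚ) = 1 →
    ∀ (𝔭' : HeightOneSpectrum (𝓞 K)), ((3 : ℕ) : 𝓞 K) ∈ 𝔭'.asIdeal → 𝔭' ≠ 𝔭 →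
    ∀ (jbar : AlgebraicClosure K →+* ℂ) (F : HeegnerFamily N' W' K κ jbar) (α : ℤ),
      α ^ 2 = 1 → F.IsNormCompatible γ α →
      (∃ n₀ : ℕ, ∀ n : ℕ, n₀ ≤ n → ∀ c : absoluteGaloisGroup K,
        c ∈ κ.layerSubgroup n → c ∉ κ.layerSubgroup (n + 1) →
        ∀ m : ℤ, m ≠ 0 → m • (c • F.z (n + 1) - F.z (n + 1)) ≠ 0) →
    ∀ (D : (W'.baseChange K).LambdaAdicSelmerData κ γ), Module.rank (IwasawaAlgebra 3) D.S ≤ 1 →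
      Module.IsTorsion (IwasawaAlgebra 3) (XAc (W'.baseChange K) 3 κ 𝔭' ∅ γ)

/-- **TORS_B — the torsion conjunct of the crux in bucket B** (derived below from MAZUR_B, RK≤1_B, PTGLUE_B; not a
stub): `X_(∅ at 𝔭, 0 at 𝔭′)(E′/K_∞)` is `Λ`-torsion. WEAKER than the crux (`torsMult_of_crux`).
[cite: BertoliniDarmonPrasanna2013, (shape only)] [cite: Castella2024MathZ, Thm. 6.2 (shape only)] -/
@[conjecture] def TwinSelmerTorsionMultAtThree : Prop :=
  ∀ (W' : WeierstrassCurve ℚ) [W'.IsElliptic] [W'.IsGloballyMinimal] (N' : ℕ) [NeZero N']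
    (K : Type) [Field K] [NumberField K] (_Dt' : ModularParametrizationData W' N'),
    Rank1Residual.Mult W' 3 → ¬ 3 ∣ padicValInt 3 W'.minimalDiscriminantInt →
    W'.HasSurjectiveModNGaloisRep 3 → W'.conductorNorm ℤ = N' → IsImaginaryQuadratic K →
    SatisfiesHeegnerHypothesis N' K → Odd (NumberField.discr K) →
    ∀ (κ : ZpExtension K 3), κ.IsAnticyclotomic →
    ∀ (γ : absoluteGaloisGroup K) [Fact (κ.IsTopGenerator γ)]
      (𝔭 : HeightOneSpectrum (𝓞 K)), ((3 : ℕ) : 𝓞 K) ∈ 𝔭.asIdeal →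
      𝔭.asIdeal.ramificationIdx (𝓞 ℚ) = 1 → 𝔭.asIdeal.inertiaDeg (𝓞 ℚ) = 1 →
    ∀ (𝔭' : HeightOneSpectrum (𝓞 K)), ((3 : ℕ) : 𝓞 K) ∈ 𝔭'.asIdeal → 𝔭' ≠ 𝔭 →
      Module.IsTorsion (IwasawaAlgebra 3) (XAc (W'.baseChange K) 3 κ 𝔭' ∅ γ)

/-- **MU_B ∣ TORS — the residual `μ = 0` conjunct of the crux in bucket B, GIVEN torsion** (stub; UNDECIDED; NOT
attacked by this node — Leaf IDEA-NEEDED, owned by rows 1 / 17 / 18 / 21 / 23): the characteristic ideal of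
`X_(∅,0)`, pushed to `𝒪^{nr}⟦T⟧`, is principal with a generator having a unit coefficient. Why it might fail: this IS
the `μ`-invariant question at `p = 3 ∥ N′` (no printed engine: `TWIN-PRINT-AT3-v1.md`); declared COSTUME-adjacent.
[cite: Castella2024MathZ, Thm. 6.2 (shape only)] [cite: Howard2004HeegnerKolyvagin, Thm. B (shape only)] -/
@[conjecture] def TwinMuZeroOfTorsionMultAtThree : Prop :=
  ∀ (W' : WeierstrassCurve ℚ) [W'.IsElliptic] [W'.IsGloballyMinimal] (N' : ℕ) [NeZero N']
    (K : Type) [Field K] [NumberField K] (_Dt' : ModularParametrizationData W' N'),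
    Rank1Residual.Mult W' 3 → ¬ 3 ∣ padicValInt 3 W'.minimalDiscriminantInt →
    W'.HasSurjectiveModNGaloisRep 3 → W'.conductorNorm ℤ = N' → IsImaginaryQuadratic K →
    SatisfiesHeegnerHypothesis N' K → Odd (NumberField.discr K) →
    ∀ (κ : ZpExtension K 3), κ.IsAnticyclotomic →
    ∀ (γ : absoluteGaloisGroup K) [Fact (κ.IsTopGenerator γ)]
      (𝔭 : HeightOneSpectrum (𝓞 K)), ((3 : ℕ) : 𝓞 K) ∈ 𝔭.asIdeal →
      𝔭.asIdeal.ramificationIdx (𝓞 ℚ) = 1 → 𝔭.asIdeal.inertiaDeg (𝓞 ℚ) = 1 →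
    ∀ (𝔭' : HeightOneSpectrum (𝓞 K)), ((3 : ℕ) : 𝓞 K) ∈ 𝔭'.asIdeal → 𝔭' ≠ 𝔭 →
      Module.IsTorsion (IwasawaAlgebra 3) (XAc (W'.baseChange K) 3 κ 𝔭' ∅ γ) →
      ∃ g' : UnrSeries 3,
        (XAc.charIdeal (W'.baseChange K) 3 κ 𝔭' ∅ γ).map (PowerSeries.map (Halves.toUnr 3)) =
            Ideal.span {g'} ∧
          ∃ i : ℕ, ‖((PowerSeries.coeff i g' : unrIntegers 3) : ℂ_[3])‖ = 1

/-! ## §2 Registered stubs -/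

theorem stub_mazurLayerMult : MazurLayerMultAtThree := by sorry
theorem stub_lambdaRankLeOneMult : LambdaRankLeOneMultAtThree := by sorry
theorem stub_torsionOfMazurRankMult : TorsionOfMazurRankMultAtThree := by sorry
theorem stub_muZeroOfTorsionMult : TwinMuZeroOfTorsionMultAtThree := by sorry
/-- C₀ bucket by name (shared leaf with `beta_road` v19 / `dihedral_parity_squeeze`). -/
theorem stub_goodSS : UniversalToricDescentBetaRoadParamDefs.TwinAlgMuZeroAtThreeGoodSSOfParam := by sorry

/-! ## §3 The torsion conjunct from the three torsion stubs (kernel-checked composition; uses `Dt'`) -/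

/-- **TORS_B from MAZUR_B, RK≤1_B and PTGLUE_B.** The Heegner family is supplied by the tree theorem
`twin_exists_isNormCompatible_heegnerFamily` (this is where the crux binder `Dt'` and the Heegner hypothesis are
consumed) and the `Λ`-adic Selmer datum by `LambdaAdicSelmerDataExists.nonempty_lambdaAdicSelmerData`. -/
theorem torsMult_of (hM : MazurLayerMultAtThree) (hR : LambdaRankLeOneMultAtThree)
    (hG : TorsionOfMazurRankMultAtThree) : TwinSelmerTorsionMultAtThree := by
  intro W' _ _ N' _ K _ _ Dt' hm htr hsurj hN hK hH hodd κ hκ γ hγ 𝔭 h𝔭 he hf 𝔭' h𝔭' hne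
  obtain ⟨ιC⟩ := (inferInstance : Nonempty (K →+* ℂ))
  letI : Algebra K ℂ := ιC.toAlgebra
  let jbar : AlgebraicClosure K →+* ℂ :=
    (IsAlgClosed.lift (R := K) (M := ℂ) (S := AlgebraicClosure K)).toRingHom
  obtain ⟨F, α, -, hα, hcoh⟩ :=
    UniversalToricDescentTwinCoherentHeegnerFamily.twin_exists_isNormCompatible_heegnerFamily
      W' N' K hm hN hK hH κ hκ γ jbar Dt'
  obtain ⟨D⟩ :=
    WeierstrassCurve.LambdaAdicSelmerDataExists.nonempty_lambdaAdicSelmerData (W'.baseChange K) 3 κ hγ.out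
  exact hG W' N' K Dt' hm htr hsurj hN hK hH hodd κ hκ γ 𝔭 h𝔭 he hf 𝔭' h𝔭' hne jbar F α hα hcoh
    (hM W' N' K Dt' hm hN hK hH κ hκ jbar F) D (hR W' N' K Dt' hm hN hK hH κ hκ γ D)

/-! ## §4 The node concludes the crux BY NAME -/

/-- **Composition**: TORS_B-stubs + (MU_B ∣ TORS) + C₀′ ⟹ crux r205 `TwinAlgMuZeroAtThree` (literally the route decl). -/
theorem TwinAlgMuZeroAtThree_of
    (hM : MazurLayerMultAtThree) (hR : LambdaRankLeOneMultAtThree) (hG : TorsionOfMazurRankMultAtThree)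
    (hMu : TwinMuZeroOfTorsionMultAtThree)
    (hC0 : UniversalToricDescentBetaRoadParamDefs.TwinAlgMuZeroAtThreeGoodSSOfParam) :
    Summit.BirchSwinnertonDyer.BirchSwinnertonDyer.Theses.UniversalToricDescent.TwinAlgMuZeroAtThree := by
  intro W' _ _ N' _ K _ _ Dt' hbucket hsurj hN hK hH hodd κ hκ γ _ 𝔭 h𝔭 he hf 𝔭' h𝔭' hne
  rcases hbucket with ⟨hm, htr⟩ | ⟨hss, ha⟩
  · have hT : Module.IsTorsion (IwasawaAlgebra 3) (XAc (W'.baseChange K) 3 κ 𝔭' ∅ γ) :=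
      torsMult_of hM hR hG W' N' K Dt' hm htr hsurj hN hK hH hodd κ hκ γ 𝔭 h𝔭 he hf 𝔭' h𝔭' hne
    exact ⟨hT, hMu W' N' K Dt' hm htr hsurj hN hK hH hodd κ hκ γ 𝔭 h𝔭 he hf 𝔭' h𝔭' hne hT⟩
  · exact (UniversalToricDescentBetaRoadParamDefs.twinAlgMuZeroAtThreeGoodSSOfParam_iff.mp hC0)
      W' N' K Dt' hss ha hsurj hN hK hH hodd κ hκ γ 𝔭 h𝔭 he hf 𝔭' h𝔭' hne

/-- **The node closes the crux from its five stubs** (inherits their `sorry`s). -/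
theorem TwinAlgMuZeroAtThree_of_stubs :
    Summit.BirchSwinnertonDyer.BirchSwinnertonDyer.Theses.UniversalToricDescent.TwinAlgMuZeroAtThree :=
  TwinAlgMuZeroAtThree_of stub_mazurLayerMult stub_lambdaRankLeOneMult stub_torsionOfMazurRankMult
    stub_muZeroOfTorsionMult stub_goodSS

/-! ## §5 Evidence: the pieces are WEAKER than the crux and implied by the line of record -/

/-- TORS_B is literally the first conjunct of the crux in bucket B. -/
theorem torsMult_of_crux
    (h : Summit.BirchSwinnertonDyer.BirchSwinnertonDyer.Theses.UniversalToricDescent.TwinAlgMuZeroAtThree) :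
    TwinSelmerTorsionMultAtThree := by
  intro W' _ _ N' _ K _ _ Dt' hm htr hsurj hN hK hH hodd κ hκ γ _ 𝔭 h𝔭 he hf 𝔭' h𝔭' hne
  exact (h W' N' K Dt' (Or.inl ⟨hm, htr⟩) hsurj hN hK hH hodd κ hκ γ 𝔭 h𝔭 he hf 𝔭' h𝔭' hne).1

/-- MU_B ∣ TORS is implied by the crux (drop the torsion hypothesis). -/
theorem muZeroOfTorsionMult_of_crux
    (h : Summit.BirchSwinnertonDyer.BirchSwinnertonDyer.Theses.UniversalToricDescent.TwinAlgMuZeroAtThree) :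
    TwinMuZeroOfTorsionMultAtThree := by
  intro W' _ _ N' _ K _ _ Dt' hm htr hsurj hN hK hH hodd κ hκ γ _ 𝔭 h𝔭 he hf 𝔭' h𝔭' hne _
  exact (h W' N' K Dt' (Or.inl ⟨hm, htr⟩) hsurj hN hK hH hodd κ hκ γ 𝔭 h𝔭 he hf 𝔭' h𝔭' hne).2

/-- TORS_B is implied by the line of record (β-road v19: K1‴ ∧ K2a‴ ⟹ bucket-B text ⟹ torsion). -/
theorem torsMult_of_betaRoad
    (hK1 : UniversalToricDescentBetaRoadParamDefs.PrincipalHeegnerIndivisibleMultOfParamAtThree)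
    (hK2 : UniversalToricDescentKsTwinLambdaDefs.KsTwinLambdaAdicAtThree) :
    TwinSelmerTorsionMultAtThree := by
  intro W' _ _ N' _ K _ _ Dt' hm htr hsurj hN hK hH hodd κ hκ γ _ 𝔭 h𝔭 he hf 𝔭' h𝔭' hne
  exact (UniversalToricDescentTwinAlgMuZeroAtThreeOfBetaRoadParam.twinAlgMuZeroAtThree_mult_of_betaRoadParam
    hK1 hK2 W' N' K Dt' hm htr hsurj hN hK hH hodd κ hκ γ 𝔭 h𝔭 he hf 𝔭' h𝔭' hne).1

/-- MU_B ∣ TORS is implied by the line of record. -/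
theorem muZeroOfTorsionMult_of_betaRoad
    (hK1 : UniversalToricDescentBetaRoadParamDefs.PrincipalHeegnerIndivisibleMultOfParamAtThree)
    (hK2 : UniversalToricDescentKsTwinLambdaDefs.KsTwinLambdaAdicAtThree) :
    TwinMuZeroOfTorsionMultAtThree := by
  intro W' _ _ N' _ K _ _ Dt' hm htr hsurj hN hK hH hodd κ hκ γ _ 𝔭 h𝔭 he hf 𝔭' h𝔭' hne _
  exact (UniversalToricDescentTwinAlgMuZeroAtThreeOfBetaRoadParam.twinAlgMuZeroAtThree_mult_of_betaRoadParam
    hK1 hK2 W' N' K Dt' hm htr hsurj hN hK hH hodd κ hκ γ 𝔭 h𝔭 he hf 𝔭' h𝔭' hne).2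

/-! ## §6 Kernel-checked pieces of the mechanism of `TorsionOfMazurRankMultAtThree` -/

/-- **Step (iii), the algebra**: an eigencomponent `e` on which `c` acts by a scalar `u` with `u − 1` invertible and
`c • e − e = 0` vanishes (used with `u = χ(c)`, `χ` primitive, `χ(c)` a primitive cube root of unity, `χ(c) − 1` a
unit away from `3` — here over `ℚ̄₃ ⊗ E′(K_n)` after inverting `3`, or over `ℂ`). -/
theorem eigencomponent_eq_zero_of_sub_smul {R M : Type*} [CommRing R] [AddCommGroup M] [Module R M]
    (u : R) (hu : IsUnit (u - 1)) (e : M) (h : u • e - e = 0) : e = 0 := by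
  have h' : (u - 1) • e = 0 := by rwa [sub_smul, one_smul]
  obtain ⟨v, hv⟩ := hu
  have : v⁻¹.val • ((u - 1) • e) = 0 := by rw [h', smul_zero]
  rwa [← hv, smul_smul, Units.inv_mul, one_smul] at this

open ZMod AddChar in
/-- **Step (ii), finite Fourier inversion on the layer Galois group `Gal(K_n/K) ≅ ℤ/3^{m+1}`** (kernel-checked, any
`ℂ`-module of values — apply it to `Φ(σ) = log_w(σ z_n)` after choosing `ℚ̄₃ ≃ ℂ`-free: the statement is linear and
holds verbatim over any field containing the `3^{m+1}`-th roots of unity; the `ℂ`-version is what Mathlib's `ZMod.dft`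
provides): if every Fourier coefficient of `Φ` at a frequency NOT divisible by `3` (= a character non-trivial on
the order-`3` subgroup `C = 3^m ℤ/3^{m+1} ℤ = Gal(K_n/K_{n−1})`) vanishes, then `Φ` is `C`-invariant. With
`Φ = log_w ∘ (σ ↦ σ z_n)` this gives `log_w((c − 1) z_n) = 0`. -/
theorem translate_invariant_of_dft_vanish_off_triples {E : Type*} [AddCommGroup E] [Module ℂ E]
    (m : ℕ) (Φ : ZMod (3 ^ (m + 1)) → E)
    (h : ∀ k : ZMod (3 ^ (m + 1)), (∀ k' : ZMod (3 ^ (m + 1)), k ≠ 3 * k') → 𝓕 Φ k = 0) :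
    ∀ j : ZMod (3 ^ (m + 1)), Φ (j + (3 ^ m : ℕ)) = Φ j := by
  set M : ZMod (3 ^ (m + 1)) := ((3 ^ m : ℕ) : ZMod (3 ^ (m + 1))) with hMdef
  have hM3 : M * 3 = 0 := by
    have h0 : ((3 ^ (m + 1) : ℕ) : ZMod (3 ^ (m + 1))) = 0 := ZMod.natCast_self _
    have h1 : M * 3 = ((3 ^ (m + 1) : ℕ) : ZMod (3 ^ (m + 1))) := by
      rw [hMdef]; push_cast; ring
    rw [h1, h0]
  set Ψ : ZMod (3 ^ (m + 1)) → E := fun j ↦ Φ (j + M) with hΨ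
  have key : ∀ k, 𝓕 Ψ k = stdAddChar (M * k) • 𝓕 Φ k := by
    intro k
    rw [dft_apply, dft_apply, Finset.smul_sum]
    exact Fintype.sum_equiv (Equiv.addRight M) _ _ (fun j ↦ by
      simp only [Equiv.coe_addRight, hΨ, smul_smul, ← map_add_eq_mul]
      congr 1; congr 1; ring)
  have hinj : 𝓕 Ψ = 𝓕 Φ := by
    funext k
    by_cases hk : ∃ k', k = 3 * k'
    · obtain ⟨k', rfl⟩ := hk
      rw [key, ← mul_assoc, hM3, zero_mul, map_zero_eq_one, one_smul]
    · push_neg at hk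
      rw [key, h k hk, smul_zero]
  have hΨΦ : Ψ = Φ := dft.injective hinj
  intro j
  exact congr_fun hΨΦ j

end Summit.BirchSwinnertonDyer.BirchSwinnertonDyer.Cruxes.TwinAlgMuZeroAtThree.MazurLogTorsion

end
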